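import Summits.FinalStateConjecture.FinalStateConjecture.Theorems.EIHFluxBalanceInertialRecessionStubEndgameBasics

/-!
# Route EIHFluxBalance — crux `InertialRecession`, abstract endgame for general `N`:
# tree telescoping over a laminar family (the virial lever identity)

Helper file for the crux `stmt-FinalStateConjecture-10166` (virial route, evidence note
`InertialRecession_endgame_generalN_virial.md`, §4(b)). Mathlib-only finite combinatorics.

A finite family `𝒩` of nonempty proper subsets of a root `K` is LAMINAR if any two members that meet are nested. Every member
`A` then has a least strict superset `par A` in `𝒩 ∪ {K}` (its parent), the members containing a given `A` form a chain from `A`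
to the root, and for ANY assignment of points `Y` to sets the levers telescope along chains:
`Σ_{ν ∈ 𝒩, A ⊆ ν} (Y ν − Y (par ν)) = Y A − Y K` (`sum_up_eq`). Consequently, when all singletons of `K` belong to `𝒩`,

  `Σ_{j ∈ K} ⟨qⱼ, Y {j} − Y K⟩ = Σ_{ν ∈ 𝒩} ⟨Σ_{j ∈ ν} qⱼ, Y ν − Y (par ν)⟩`   (`sum_inner_lever_eq_sum_nodes`),

which is the multi-level form of `virial_regroup` (file `…VirialIdentity`): momentum increments `qⱼ` paired with levers to the
root are regrouped into NODE increments `Σ_{j∈ν} qⱼ` paired with the short levers `Y ν − Y (par ν)`.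
`exists_parent` constructs a parent map with the three properties the identity consumes.
-/

noncomputable section


open Finset

namespace Summit.FinalStateConjecture.FinalStateConjecture.Theorems.SublinearIsFree.Virial

open Literature.Geometry.Lorentzian

variable {ι : Type*} [DecidableEq ι]

/-! ### Parents in a laminar family -/

/-- **Parents exist.** In a laminar family `𝒩` of nonempty strict subsets of `K` there is a map `par` with: `A ⊂ par A`;
`par A ∈ 𝒩` or `par A = K`; and minimality — every strict superset of `A` in `𝒩 ∪ {K}` contains `par A`. (Take a strict
superset in `𝒩` of least cardinality if there is one, else `K`; laminarity makes it least for inclusion.) [folklore] -/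
theorem exists_parent (𝒩 : Finset (Finset ι)) (K : Finset ι)
    (hlam : ∀ A ∈ 𝒩, ∀ B ∈ 𝒩, (A ∩ B).Nonempty → A ⊆ B ∨ B ⊆ A)
    (hne : ∀ A ∈ 𝒩, A.Nonempty) (hsub : ∀ A ∈ 𝒩, A ⊂ K) :
    ∃ par : Finset ι → Finset ι, (∀ A ∈ 𝒩, A ⊂ par A) ∧ (∀ A ∈ 𝒩, par A ∈ 𝒩 ∨ par A = K) ∧
      ∀ A ∈ 𝒩, ∀ B, (B ∈ 𝒩 ∨ B = K) → A ⊂ B → par A ⊆ B := by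
  classical
  -- least-cardinality strict superset, when there is one
  have hmin : ∀ A : Finset ι, (𝒩.filter fun B ↦ A ⊂ B).Nonempty →
      ∃ B₀ ∈ 𝒩.filter (fun B ↦ A ⊂ B), ∀ B ∈ 𝒩.filter (fun B ↦ A ⊂ B), B₀.card ≤ B.card := fun A h ↦
    Finset.exists_min_image _ Finset.card h
  choose! m hm hmle using hmin
  refine ⟨fun A ↦ if h : (𝒩.filter fun B ↦ A ⊂ B).Nonempty then m A else K, ?_, ?_, ?_⟩
  · intro A hA
    dsimp only
    by_cases h : (𝒩.filter fun B ↦ A ⊂ B).Nonempty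
    · rw [dif_pos h]
      exact (Finset.mem_filter.mp (hm A h)).2
    · rw [dif_neg h]
      exact hsub A hA
  · intro A _
    dsimp only
    by_cases h : (𝒩.filter fun B ↦ A ⊂ B).Nonempty
    · rw [dif_pos h]
      exact Or.inl (Finset.mem_filter.mp (hm A h)).1
    · rw [dif_neg h]
      exact Or.inr rfl
  · intro A hA B hB hAB
    dsimp only
    rcases hB with hB | rfl
    · have h : (𝒩.filter fun B ↦ A ⊂ B).Nonempty := ⟨B, Finset.mem_filter.mpr ⟨hB, hAB⟩⟩
      rw [dif_pos h]
      have hm𝒩 : m A ∈ 𝒩 := (Finset.mem_filter.mp (hm A h)).1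
      have hAm : A ⊂ m A := (Finset.mem_filter.mp (hm A h)).2
      have hmeet : (m A ∩ B).Nonempty := by
        obtain ⟨x, hx⟩ := hne A hA
        exact ⟨x, Finset.mem_inter.mpr ⟨hAm.1 hx, hAB.1 hx⟩⟩
      rcases hlam _ hm𝒩 _ hB hmeet with h1 | h1
      · exact h1
      · -- `B ⊆ m A` and `card (m A) ≤ card B` force equality
        have hle : (m A).card ≤ B.card := hmle A h B (Finset.mem_filter.mpr ⟨hB, hAB⟩)
        exact (Finset.eq_of_subset_of_card_le h1 hle).symm.subset
    · by_cases h : (𝒩.filter fun B ↦ A ⊂ B).Nonempty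
      · rw [dif_pos h]
        exact (hsub _ (Finset.mem_filter.mp (hm A h)).1).1
      · rw [dif_neg h]

/-! ### Telescoping along chains -/

section Chain

variable {𝒩 : Finset (Finset ι)} {K : Finset ι} {par : Finset ι → Finset ι}

/-- The members above `par A` are exactly the members above `A` other than `A` itself. [folklore] -/
theorem filter_subset_parent_eq (hp₁ : ∀ A ∈ 𝒩, A ⊂ par A)
    (hp₃ : ∀ A ∈ 𝒩, ∀ B, (B ∈ 𝒩 ∨ B = K) → A ⊂ B → par A ⊆ B) {A : Finset ι} (hA : A ∈ 𝒩) :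
    𝒩.filter (fun ν ↦ par A ⊆ ν) = (𝒩.filter fun ν ↦ A ⊆ ν).erase A := by
  ext ν
  simp only [Finset.mem_filter, Finset.mem_erase]
  constructor
  · rintro ⟨hν, hpν⟩
    have hAν : A ⊂ ν := (hp₁ A hA).trans_subset hpν
    exact ⟨hAν.ne', hν, hAν.1⟩
  · rintro ⟨hne, hν, hAν⟩
    exact ⟨hν, hp₃ A hA ν (Or.inl hν) (Finset.ssubset_iff_subset_ne.mpr ⟨hAν, Ne.symm hne⟩)⟩

/-- If the parent of `A` is the root, no member of `𝒩` lies strictly above `A`. [folklore] -/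
theorem filter_subset_eq_singleton_of_parent_eq (hsub : ∀ A ∈ 𝒩, A ⊂ K)
    (hp₃ : ∀ A ∈ 𝒩, ∀ B, (B ∈ 𝒩 ∨ B = K) → A ⊂ B → par A ⊆ B) {A : Finset ι} (hA : A ∈ 𝒩)
    (hpA : par A = K) : 𝒩.filter (fun ν ↦ A ⊆ ν) = {A} := by
  ext ν
  simp only [Finset.mem_filter, Finset.mem_singleton]
  constructor
  · rintro ⟨hν, hAν⟩
    by_contra hne
    have hss : A ⊂ ν := Finset.ssubset_iff_subset_ne.mpr ⟨hAν, Ne.symm hne⟩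
    have hK : K ⊆ ν := hpA ▸ hp₃ A hA ν (Or.inl hν) hss
    exact (hsub ν hν).2 hK
  · rintro rfl
    exact ⟨hA, Finset.Subset.refl _⟩

/-- **Chain telescoping.** For any points `Y`, the levers of the members above `A ∈ 𝒩` telescope:
`Σ_{ν ∈ 𝒩, A ⊆ ν} (Y ν − Y (par ν)) = Y A − Y K`. [folklore] -/
theorem sum_up_eq {V : Type*} [AddCommGroup V] (hsub : ∀ A ∈ 𝒩, A ⊂ K) (hp₁ : ∀ A ∈ 𝒩, A ⊂ par A)
    (hp₂ : ∀ A ∈ 𝒩, par A ∈ 𝒩 ∨ par A = K)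
    (hp₃ : ∀ A ∈ 𝒩, ∀ B, (B ∈ 𝒩 ∨ B = K) → A ⊂ B → par A ⊆ B) (Y : Finset ι → V) :
    ∀ A ∈ 𝒩, ∑ ν ∈ 𝒩.filter (fun ν ↦ A ⊆ ν), (Y ν - Y (par ν)) = Y A - Y K := by
  -- strong induction on the number of members above `A`
  suffices h : ∀ n : ℕ, ∀ A ∈ 𝒩, (𝒩.filter fun ν ↦ A ⊆ ν).card = n →
      ∑ ν ∈ 𝒩.filter (fun ν ↦ A ⊆ ν), (Y ν - Y (par ν)) = Y A - Y K from
    fun A hA ↦ h _ A hA rfl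
  intro n
  induction n using Nat.strong_induction_on with
  | _ n ih =>
    intro A hA hcard
    rcases hp₂ A hA with hpA | hpA
    · -- peel off `A`; what remains is the chain above `par A`
      have hAmem : A ∈ 𝒩.filter (fun ν ↦ A ⊆ ν) := Finset.mem_filter.mpr ⟨hA, Finset.Subset.refl _⟩
      have hrest := filter_subset_parent_eq hp₁ hp₃ hA
      have hlt : (𝒩.filter fun ν ↦ par A ⊆ ν).card < n := by
        rw [hrest, Finset.card_erase_of_mem hAmem, hcard]
        have : 0 < n := by rw [← hcard]; exact Finset.card_pos.mpr ⟨A, hAmem⟩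
        omega
      have hih := ih _ hlt (par A) hpA rfl
      rw [← Finset.add_sum_erase _ _ hAmem, ← hrest, hih]
      abel
    · rw [filter_subset_eq_singleton_of_parent_eq hsub hp₃ hA hpA, Finset.sum_singleton, hpA]

end Chain

/-! ### The lever identity -/

/-- Swapping a sum over nodes-then-members into members-then-nodes (all nodes are subsets of `K`). [folklore] -/
theorem sum_nodes_sum_members_comm {V : Type*} [AddCommMonoid V] (𝒩 : Finset (Finset ι)) (K : Finset ι)
    (hsub : ∀ A ∈ 𝒩, A ⊆ K) (f : Finset ι → ι → V) :
    ∑ ν ∈ 𝒩, ∑ j ∈ ν, f ν j = ∑ j ∈ K, ∑ ν ∈ 𝒩.filter (fun ν ↦ j ∈ ν), f ν j := by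
  rw [Finset.sum_comm' (t' := K) (s' := fun j ↦ 𝒩.filter fun ν ↦ j ∈ ν)]
  intro ν j
  simp only [Finset.mem_filter]
  constructor
  · rintro ⟨hν, hj⟩
    exact ⟨⟨hν, hj⟩, hsub ν hν hj⟩
  · rintro ⟨⟨hν, hj⟩, _⟩
    exact ⟨hν, hj⟩

/-- **THE LEVER IDENTITY (tree telescoping over a laminar family).** Let `𝒩` be a family of strict subsets of `K` with a
parent map `par` (`A ⊂ par A ∈ 𝒩 ∪ {K}`, least among strict supersets) and containing every singleton of `K`. Then for
all increments `q : ι → E3` and all points `Y`: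
`Σ_{j∈K} ⟨qⱼ, Y {j} − Y K⟩ = Σ_{ν∈𝒩} ⟨Σ_{j∈ν} qⱼ, Y ν − Y (par ν)⟩`. [folklore] -/
theorem sum_inner_lever_eq_sum_nodes' (𝒩 : Finset (Finset ι)) (K : Finset ι) (par : Finset ι → Finset ι)
    (hsub : ∀ A ∈ 𝒩, A ⊂ K) (hp₁ : ∀ A ∈ 𝒩, A ⊂ par A) (hp₂ : ∀ A ∈ 𝒩, par A ∈ 𝒩 ∨ par A = K)
    (hp₃ : ∀ A ∈ 𝒩, ∀ B, (B ∈ 𝒩 ∨ B = K) → A ⊂ B → par A ⊆ B) (hsing : ∀ j ∈ K, ({j} : Finset ι) ∈ 𝒩)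
    (q : ι → E3) (Y : Finset ι → E3) :
    ∑ j ∈ K, inner ℝ (q j) (Y {j} - Y K) = ∑ ν ∈ 𝒩, inner ℝ (∑ j ∈ ν, q j) (Y ν - Y (par ν)) := by
  -- expand the node sums and swap
  have h1 : ∑ ν ∈ 𝒩, inner ℝ (∑ j ∈ ν, q j) (Y ν - Y (par ν)) =
      ∑ ν ∈ 𝒩, ∑ j ∈ ν, inner ℝ (q j) (Y ν - Y (par ν)) := by
    refine Finset.sum_congr rfl fun ν _ ↦ ?_
    rw [sum_inner]
  rw [h1, sum_nodes_sum_members_comm 𝒩 K (fun A hA ↦ (hsub A hA).1)]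
  refine Finset.sum_congr rfl fun j hj ↦ ?_
  rw [← inner_sum]
  congr 1
  -- the nodes containing `j` are the nodes above `{j}`
  have hfilt : 𝒩.filter (fun ν ↦ j ∈ ν) = 𝒩.filter (fun ν ↦ ({j} : Finset ι) ⊆ ν) := by
    refine Finset.filter_congr fun ν _ ↦ ?_
    rw [Finset.singleton_subset_iff]
  rw [hfilt]
  exact (sum_up_eq hsub hp₁ hp₂ hp₃ Y {j} (hsing j hj)).symm

/-- Registered one-line form of `sum_inner_lever_eq_sum_nodes'`. [folklore] -/
theorem sum_inner_lever_eq_sum_nodes : open Literature.Geometry.Lorentzian Finset in ∀ {ι : Type*} [DecidableEq ι] (𝒩 : Finset (Finset ι)) (K : Finset ι) (par : Finset ι → Finset ι), (∀ A ∈ 𝒩, A ⊂ K) → (∀ A ∈ 𝒩, A ⊂ par A) → (∀ A ∈ 𝒩, par A ∈ 𝒩 ∨ par A = K) → (∀ A ∈ 𝒩, ∀ B, (B ∈ 𝒩 ∨ B = K) → A ⊂ B → par A ⊆ B) → (∀ j ∈ K, ({j} : Finset ι) ∈ 𝒩) → ∀ (q : ι → E3) (Y : Finset ι → E3), ∑ j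 ∈ K, inner ℝ (q j) (Y {j} - Y K) = ∑ ν ∈ 𝒩, inner ℝ (∑ j ∈ ν, q j) (Y ν - Y (par ν)) :=
  fun 𝒩 K par hsub hp₁ hp₂ hp₃ hsing q Y ↦ sum_inner_lever_eq_sum_nodes' 𝒩 K par hsub hp₁ hp₂ hp₃ hsing q Y

omit [DecidableEq ι] in
/-- A family of subsets of `K` has at most `2 ^ |K|` members (crude count of the alive nodes). [folklore] -/
theorem card_le_two_pow_of_subset (𝒩 : Finset (Finset ι)) (K : Finset ι) (hsub : ∀ A ∈ 𝒩, A ⊆ K) :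
    𝒩.card ≤ 2 ^ K.card := by
  calc 𝒩.card ≤ K.powerset.card := Finset.card_le_card fun A hA ↦ Finset.mem_powerset.mpr (hsub A hA)
    _ = 2 ^ K.card := Finset.card_powerset K

end Summit.FinalStateConjecture.FinalStateConjecture.Theorems.SublinearIsFree.Virial

end
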